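import Summits.QuantumAdvantage.QuantumAdvantage.Theses.CompactnessLift
import Summits.QuantumAdvantage.QuantumAdvantage.Theorems.CompactnessLiftLanguageLadderSummitStrength
import Summits.QuantumAdvantage.QuantumAdvantage.Theorems.CompactnessPrinciple.Negative.SliceZeroEmpty
import Literature.Computability.QuantumComplexity.BQTime

/-!
# `LanguageLadder` (crux stmt-QuantumAdvantage-15271, route `CompactnessLift`) — the shape of a
# refutation and the rung structure of the typed ladder: monotone rungs, every tail is the crux

Negative-side lemmas extracted from the disprover work file
`Summits/QuantumAdvantage/QuantumAdvantage/Cruxes/LanguageLadder/Disproof.lean`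
(refuter-cdisprove-stmt-QuantumAdvantage-15271-0, cycle 1) so that planners, provers and later
refuter seats can import them. Sorry-free; axioms ⊆ {propext, Classical.choice, Quot.sound}; no
statement of the route is asserted positively and no definition is introduced (the route's inlined
class `QuadQ` is `Literature.Computability.QuantumComplexity.BQTime (fun n => n ^ 2)` by `rfl`,
tree `CompactnessLiftLanguageLadder.languageLadder_iff_forall_exists`).

The crux is `LanguageLadder := ∀ c, ∃ L ∈ BQTime (·^2), L ∉ bp (DTIME (·^c))`. Imported and reused,
not restated: rung `c = 0` is empty / says `QuadQ ≠ ∅` (sibling disprover's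
`CompactnessPrinciple.Negative.SliceZeroEmpty`: `DTIME_pow_zero_eq_empty`, `bp_DTIME_pow_zero_eq_empty`,
`exists_not_mem_bp_DTIME_pow_zero_iff`), every rung class lies in `BPP` and the padding collapse makes
some rung class equal to `BPP` (`CompactnessLiftLanguageLadder.bp_DTIME_pow_subset_BPP`,
`CompactnessLiftPadding.paddingCollapse`, landed for the sibling crux 15270).

What this file adds (the disprover's reading of the quantifier structure):

* WHAT A KILL IS, literally: one exponent `c` with `BQTime (·^2) ⊆ bp (DTIME (·^c))`
  (`not_languageLadder_iff`; by the tree's `not_languageLadder_iff_BQTime_two_subset_BPP` this is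
  exactly the dequantization `BQTime (·^2) ⊆ BPP` — the `¬ QuantumAdvantage` programme in the
  quadratic window, nothing cheaper).
* RUNG `0` IS IMPLIED BY EVERY OTHER RUNG (`languageLadder_iff_forall_pos`).
* THE RUNGS ARE MONOTONE from `c = 1` on (`bp_DTIME_pow_mono`, `rung_anti`), so the crux equals each
  of its tails and even "infinitely many rungs" (`languageLadder_iff_tail`,
  `languageLadder_iff_frequently`), and a kill at one exponent is a kill at every larger one
  (`not_languageLadder_iff_eventually`): there is no low rung to pick off and no rung split that
  weakens the statement.
* ALL BUT FINITELY MANY RUNG CLASSES ARE `BPP` (`exists_forall_ge_bp_DTIME_pow_eq_BPP`, padding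
  collapse + monotonicity): up to finitely many low rungs it is anyway equivalent without, the typed
  ladder has ONE rung, `BQTime (·^2) ⊄ BPP`.
-/

set_option linter.dupNamespace false

namespace Summit.QuantumAdvantage.QuantumAdvantage.Theorems.LanguageLadder.Negative

open Literature.Computability.Complexity Literature.Computability.QuantumComplexity
  Literature.Computability.Cryptography
open Summit.QuantumAdvantage.QuantumAdvantage.Theses.CompactnessLift (LanguageLadder)
open Summit.QuantumAdvantage.QuantumAdvantage.Theorems.CompactnessPrinciple.Negative
  (bp_DTIME_pow_zero_eq_empty exists_not_mem_bp_DTIME_pow_zero_iff)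
open Summit.QuantumAdvantage.QuantumAdvantage.Theorems.CompactnessLiftLanguageLadder
  (languageLadder_iff_forall_exists bp_DTIME_pow_subset_BPP)

/-! ### What a kill is -/

/-- A refutation of the crux is literally ONE exponent `c` at which every quadratic-time-uniform
Clifford+T language lies in `bp (DTIME (·^c))`. [folklore] -/
theorem not_languageLadder_iff :
    ¬ LanguageLadder ↔ ∃ c : ℕ, BQTime (fun n => n ^ 2) ⊆ bp (DTIME fun n => n ^ c) := by
  simp only [languageLadder_iff_forall_exists, not_forall, not_exists, not_and, not_not]
  rfl

/-! ### Rung `0` is implied by every other rung -/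

/-- Rung `c = 0` says only `BQTime (·^2) ≠ ∅` (sibling `exists_not_mem_bp_DTIME_pow_zero_iff`), which
any witness of any other rung supplies: the crux is its positive-exponent part. [folklore] -/
theorem languageLadder_iff_forall_pos :
    LanguageLadder ↔ ∀ c : ℕ, 1 ≤ c → ∃ L ∈ BQTime (fun n => n ^ 2), L ∉ bp (DTIME fun n => n ^ c) := by
  refine ⟨fun h c _ => h c, fun h c => ?_⟩
  rcases Nat.eq_zero_or_pos c with rfl | hc
  · obtain ⟨L, hL, -⟩ := h 1 le_rfl
    exact (exists_not_mem_bp_DTIME_pow_zero_iff _).2 ⟨L, hL⟩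
  · exact h c hc

/-! ### The rungs are monotone: every tail is the crux, a kill at `c` kills all `c' ≥ c` -/

/-- The rung classes increase with the exponent (from `1` on; rung `0` is empty,
`bp_DTIME_pow_zero_eq_empty`). [folklore] -/
theorem bp_DTIME_pow_mono {c c' : ℕ} (hc : 1 ≤ c) (h : c ≤ c') :
    bp (DTIME fun n : ℕ => n ^ c) ⊆ bp (DTIME fun n : ℕ => n ^ c') := by
  refine bp_mono (DTIME_mono fun n => ?_)
  rcases Nat.eq_zero_or_pos n with rfl | hn
  · rw [zero_pow (by omega : c ≠ 0)]; exact Nat.zero_le _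
  · exact Nat.pow_le_pow_right hn h

/-- From rung `0` every rung class is monotone (the empty class is below everything). [folklore] -/
theorem bp_DTIME_pow_mono' {c c' : ℕ} (h : c ≤ c') :
    bp (DTIME fun n : ℕ => n ^ c) ⊆ bp (DTIME fun n : ℕ => n ^ c') := by
  rcases Nat.eq_zero_or_pos c with rfl | hc
  · rw [bp_DTIME_pow_zero_eq_empty]; exact Set.empty_subset _
  · exact bp_DTIME_pow_mono hc h

/-- A higher rung implies every lower rung. [folklore] -/
theorem rung_anti {c c' : ℕ} (h : c ≤ c')
    (h' : ∃ L ∈ BQTime (fun n => n ^ 2), L ∉ bp (DTIME fun n : ℕ => n ^ c')) :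
    ∃ L ∈ BQTime (fun n => n ^ 2), L ∉ bp (DTIME fun n : ℕ => n ^ c) := by
  obtain ⟨L, hL, hB⟩ := h'
  exact ⟨L, hL, fun hm => hB (bp_DTIME_pow_mono' h hm)⟩

/-- **Every tail is the crux**: for every `c₀`, `LanguageLadder ↔ ∀ c ≥ c₀, rung c`. There is no
finite set of "low rungs" whose removal weakens the statement. [folklore] -/
theorem languageLadder_iff_tail (c₀ : ℕ) :
    LanguageLadder ↔ ∀ c : ℕ, c₀ ≤ c → ∃ L ∈ BQTime (fun n => n ^ 2), L ∉ bp (DTIME fun n => n ^ c) :=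
  ⟨fun h c _ => h c, fun h c => rung_anti (le_max_left c c₀) (h (max c c₀) (le_max_right _ _))⟩

/-- Even "infinitely many rungs" is the crux. [folklore] -/
theorem languageLadder_iff_frequently :
    LanguageLadder ↔ ∀ c₀ : ℕ, ∃ c, c₀ ≤ c ∧ ∃ L ∈ BQTime (fun n => n ^ 2), L ∉ bp (DTIME fun n => n ^ c) := by
  refine ⟨fun h c₀ => ⟨c₀, le_rfl, h c₀⟩, fun h c => ?_⟩
  obtain ⟨c', hcc', h'⟩ := h c
  exact rung_anti hcc' h'

/-- **A kill at one exponent is a kill at every larger exponent** — the disprover may aim as high as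
convenient, but every target is `⊆ BPP` (`bp_DTIME_pow_subset_BPP`). [folklore] -/
theorem not_languageLadder_iff_eventually :
    ¬ LanguageLadder ↔ ∃ c₀ : ℕ, ∀ c, c₀ ≤ c → BQTime (fun n => n ^ 2) ⊆ bp (DTIME fun n => n ^ c) := by
  rw [not_languageLadder_iff]
  exact ⟨fun ⟨c, hc⟩ => ⟨c, fun c' hc' => hc.trans (bp_DTIME_pow_mono' hc')⟩,
    fun ⟨c₀, h⟩ => ⟨c₀, h c₀ le_rfl⟩⟩

/-- **All but finitely many rung classes ARE `BPP`**: from the tree's padding collapse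
`∃ c₀, BPP ⊆ bp (DTIME (·^c₀))` (`CompactnessLiftPadding.paddingCollapse`) and monotonicity,
`bp (DTIME (·^c)) = BPP` for every `c ≥ c₀` (and necessarily `1 ≤ c₀`, the rung-`0` class being
empty while `BPP` is not — not needed here). So up to finitely many low rungs it is anyway
equivalent without (`languageLadder_iff_tail`), the typed ladder has ONE rung: `BQTime (·^2) ⊄ BPP`
(tree `languageLadder_iff_not_BQTime_two_subset_BPP`). [folklore] -/
theorem exists_forall_ge_bp_DTIME_pow_eq_BPP :
    ∃ c₀ : ℕ, ∀ c : ℕ, c₀ ≤ c → bp (DTIME fun n : ℕ => n ^ c) = BPP := by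
  obtain ⟨c₀, h⟩ := CompactnessLiftPadding.paddingCollapse
  exact ⟨c₀, fun c hc => (bp_DTIME_pow_subset_BPP c).antisymm (h.trans (bp_DTIME_pow_mono' hc))⟩

end Summit.QuantumAdvantage.QuantumAdvantage.Theorems.LanguageLadder.Negative
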